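import Summits.PneNP.PneNP.Theorems.RamseyUncertifiableResolutionUncertaintyTreeLike

/-!
# PIN-MONOTONE (dag-like) refutations of the unary clique CNF enumerate cliques, I: the walk — item stmt-PneNP-9816
# `RamseyUncertifiable.ResolutionUncertainty` (support): the typed sub-target `PinMonotoneCoreHardness` of the
# line `box-dag-self-gadget-lifting` (Cruxes/ResolutionUncertainty/Lines/box-dag-self-gadget-lifting.lean), settled

A resolution derivation is PIN-MONOTONE (`IsPinMonotone`, the line's typed definition, copied verbatim) if no
backward step into a NON-INITIAL premise drops a negative literal ("pin"): every negative literal of a resolvent lies in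
each non-initial premise (the negative pivot excepted on the negative side), and likewise for weakenings. Tree-like
brute force and its dag-like variants that SHARE no-goods `¬Q` across block orderings are pin-monotone; PARKING (the
obstruction to clause-local adversary arguments found by lead gen-0) is exactly what pin-monotonicity forbids.

`pinMonotone_cliqueCNF_length_ge_card_cliqueFinset`: every pin-monotone resolution refutation `π` of the unary
`Clique(G, k)` — dag-like, no tree-likeness assumed — has at least `#(t-cliques of G)` lines, for every `t`.

Proof (the Delayer injection of `…TreeLike.lean`, without trees). Walk down `π` with Delayer `Q` (a clique): the walk
ends on a block axiom and its final record pins exactly `Q` (`TreeLike.pins_leaf`). Before the walk reaches that axiom it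
only visits non-initial lines, so by pin-monotonicity the set of negative literals of the current clause only GROWS;
every pin `x_{i,q} = 1` of the record was acquired at a resolution step entering the premise that contains `¬x_{i,q}`,
a non-initial line (an initial one would be the final block axiom, which has no negative literal); hence the LAST
non-initial clause `C⋆(Q)` on the walk contains `¬x_{i,q}` for every `q ∈ Q`, and, being falsified by the record, no other
negative literal: its negative variables are exactly the pin variables of `Q`, which determine `Q`. So `Q ↦ C⋆(Q)` is
injective. Consequently (`pinMonotoneCoreHardness`) the lever of the line holds for pin-monotone refutations: the
difficulty of the (open, dag-like) item is entirely in pin-dropping steps.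
-/

set_option linter.dupNamespace false

namespace Summit.PneNP.PneNP.Theorems.RamseyUncertifiableResolutionUncertainty

open Literature.Computability.Complexity Literature.Computability.MetaComplexity
open Summit.PneNP.PneNP.Theorems.RegularResolutionRung.Negative (cliqueCNF)

/-- A derivation is PIN-MONOTONE if no backward step into a NON-initial premise drops a negative literal: for a
resolution line with premises `i` (containing the positive pivot) and `j` (containing the negative pivot), every
negative literal of the conclusion lies in premise `i` unless premise `i` is an initial clause, and every negative
literal of the conclusion other than the negative pivot lies in premise `j` unless premise `j` is initial; likewise for
weakenings. (Verbatim the typed sub-target of `Cruxes/ResolutionUncertainty/Lines/box-dag-self-gadget-lifting.lean`.) -/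
def IsPinMonotone (π : List (ResLine ℕ)) : Prop :=
  ∀ t (ht : t < π.length),
    match (π[t]'ht).rule with
    | .initial => True
    | .resolve i j v =>
        (∀ hi : i < π.length, (π[i]'hi).rule ≠ .initial →
          ∀ l ∈ (π[t]'ht).clause, l.2 = false → l ∈ (π[i]'hi).clause) ∧
        (∀ hj : j < π.length, (π[j]'hj).rule ≠ .initial →
          ∀ l ∈ (π[t]'ht).clause, l.2 = false → l ≠ (v, false) → l ∈ (π[j]'hj).clause)
    | .weaken i =>
        ∀ hi : i < π.length, (π[i]'hi).rule ≠ .initial →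
          ∀ l ∈ (π[t]'ht).clause, l.2 = false → l ∈ (π[i]'hi).clause

namespace TreeLike

section WalkMono

variable {φ : CNF ℕ} {π : List (ResLine ℕ)} (ans : (ℕ → Option Bool) → ℕ → Bool) {r : ℕ}

/-- A step from an initial line does nothing. -/
theorem step_eq_of_initial (st : ℕ × (ℕ → Option Bool)) (hst : st.1 < π.length)
    (hinit : (π[st.1]'hst).rule = .initial) : step π ans st = st := by
  unfold step
  rw [dif_pos hst, hinit]
  rfl

/-- From an initial line on, the walk is constant. -/
theorem run_const_of_initial (s : ℕ) (hs : (run π ans r s).1 < π.length)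
    (hinit : (π[(run π ans r s).1]'hs).rule = .initial) (d : ℕ) : run π ans r (s + d) = run π ans r s := by
  induction d with
  | zero => rfl
  | succ d ih =>
    show step π ans (run π ans r (s + d)) = run π ans r s
    rw [ih]
    exact step_eq_of_initial ans _ hs hinit

/-- **Pin-monotone steps keep negative literals.** If the walk moves from a line to a NON-initial line `c'`,
every negative literal of the old clause is a literal of the clause of `c'`. -/
theorem step_neg_subset (hπ : IsResDerivation φ π) (hmono : IsPinMonotone π) (st : ℕ × (ℕ → Option Bool))
    (hst : st.1 < π.length) {c' : ℕ} (hc' : (step π ans st).1 = c') (hlt' : c' < π.length)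
    (hni : (π[c']'hlt').rule ≠ .initial) :
    ∀ l ∈ (π[st.1]'hst).clause, l.2 = false → l ∈ (π[c']'hlt').clause := by
  have hv := hπ st.1 hst
  have hm := hmono st.1 hst
  have hlen : (π.take st.1).length = st.1 := by simp [hst.le]
  unfold IsValidResLine at hv
  unfold step at hc'
  rw [dif_pos hst] at hc'
  rcases hrule : (π[st.1]'hst).rule with _ | ⟨i, j, v⟩ | ⟨i⟩
  · rw [hrule] at hc'
    simp only [stepRule] at hc'
    subst hc'
    exact absurd hrule hni
  · rw [hrule] at hv hm hc'
    obtain ⟨hi, hj, hres⟩ := hv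
    rw [List.getElem_take, List.getElem_take] at hres
    obtain ⟨-, hD, -⟩ := hres
    obtain ⟨hmi, hmj⟩ := hm
    simp only [stepRule] at hc'
    cases hb : pivotVal ans st.2 v
    · rw [hb] at hc'
      simp only [Bool.false_eq_true, ↓reduceIte] at hc'
      subst hc'
      intro l hl hl2
      exact hmi hlt' hni l hl hl2
    · rw [hb] at hc'
      simp only [↓reduceIte] at hc'
      subst hc'
      intro l hl hl2
      by_cases hlv : l = (v, false)
      · rw [hlv]; exact hD
      · exact hmj hlt' hni l hl hl2 hlv
  · rw [hrule] at hm hc'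
    simp only [stepRule] at hc'
    subst hc'
    intro l hl hl2
    exact hm hlt' hni l hl hl2

/-- A fresh `true` recorded at a step sits, negatively, in the clause the step moves to. -/
theorem step_new_true (hπ : IsResDerivation φ π) (st : ℕ × (ℕ → Option Bool)) (hst : st.1 < π.length)
    {c' : ℕ} {ρ' : ℕ → Option Bool} (hc' : (step π ans st).1 = c') (hρ' : (step π ans st).2 = ρ')
    (hlt' : c' < π.length) {w : ℕ} (hold : st.2 w ≠ some true) (hnew : ρ' w = some true) :
    (w, false) ∈ (π[c']'hlt').clause := by
  have hv := hπ st.1 hst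
  have hlen : (π.take st.1).length = st.1 := by simp [hst.le]
  unfold IsValidResLine at hv
  unfold step at hc' hρ'
  rw [dif_pos hst] at hc' hρ'
  rcases hrule : (π[st.1]'hst).rule with _ | ⟨i, j, v⟩ | ⟨i⟩
  · rw [hrule] at hρ'
    simp only [stepRule] at hρ'
    subst hρ'
    exact absurd hnew hold
  · rw [hrule] at hv hc' hρ'
    obtain ⟨hi, hj, hres⟩ := hv
    rw [List.getElem_take, List.getElem_take] at hres
    obtain ⟨-, hD, -⟩ := hres
    simp only [stepRule] at hc' hρ'
    subst hρ'
    by_cases hwv : w = v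
    · subst hwv
      simp only [↓reduceIte] at hnew
      have hb : pivotVal ans st.2 w = true := Option.some.inj hnew
      rw [hb] at hc'
      simp only [↓reduceIte] at hc'
      subst hc'
      exact hD
    · simp only at hnew
      rw [if_neg hwv] at hnew
      exact absurd hnew hold
  · rw [hrule] at hρ'
    simp only [stepRule] at hρ'
    subst hρ'
    exact absurd hnew hold

end WalkMono

section LastLine

variable {n k : ℕ} (G : SimpleGraph (Fin n)) [DecidableRel G.Adj] {π : List (ResLine ℕ)} {r : ℕ}

/-- `true` entries of Delayer `Q`'s records are block variables `x_{i,v}` with `i < k` and `v ∈ Q`. -/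
theorem run_true_form (Q : Finset (Fin n)) (s : ℕ) {w : ℕ} (hw : (run π (answer n k Q) r s).2 w = some true) :
    ∃ i < k, ∃ v : Fin n, w = i * n + (v : ℕ) ∧ v ∈ Q := by
  induction s with
  | zero => simp [run] at hw
  | succ s ih =>
    rw [run_succ] at hw
    by_cases hold : (run π (answer n k Q) r s).2 w = some true
    · exact ih hold
    · -- the entry is fresh: it is the answer at a resolution step on `w`
      revert hw
      unfold step
      split_ifs with hlt
      · rcases (π[(run π (answer n k Q) r s).1]'hlt).rule with _ | ⟨i, j, v⟩ | ⟨i⟩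
        · intro hw; exact absurd hw hold
        · simp only [stepRule]
          intro hw
          by_cases hwv : w = v
          · subst hwv
            simp only [↓reduceIte] at hw
            have hb : pivotVal (answer n k Q) (run π (answer n k Q) r s).2 w = true := Option.some.inj hw
            unfold pivotVal at hb
            rcases hρ : (run π (answer n k Q) r s).2 w with _ | b
            · rw [hρ] at hb
              simp only [Option.getD_none, answer, decide_eq_true_eq] at hb
              obtain ⟨i', hi', v', hw', hv', -, -⟩ := hb
              exact ⟨i', hi', v', hw', hv'⟩
            · rw [hρ] at hb
              simp only [Option.getD_some] at hb
              subst hb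
              exact absurd hρ hold
          · rw [if_neg hwv] at hw
            exact absurd hw hold
        · intro hw; exact absurd hw hold
      · intro hw; exact absurd hw hold

/-- The final (halting) line of Delayer `Q`'s walk carries a block axiom: no negative literal. -/
theorem final_no_neg (hπ : IsResDerivation (cliqueCNF n k fun u v => decide (G.Adj u v)) π) (hr : r < π.length)
    (hroot : (π[r]'hr).clause = ∅) {Q : Finset (Fin n)} (hQ : G.IsClique (Q : Set (Fin n))) :
    ∀ l ∈ (π[(run π (answer n k Q) r π.length).1]'(run_fst_lt _ hπ hr _)).clause, l.2 = true := by
  have hmem := final_mem (answer n k Q) hπ hr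
  obtain ⟨c, hc, hceq⟩ := List.mem_map.1 hmem
  have hf := run_falsifies (answer n k Q) hπ hr hroot π.length
  have hD : DInv n k Q (run π (answer n k Q) r π.length).2 := dInv_run _
  rw [← hceq] at hf ⊢
  -- read the shape of `c` off `cliqueCNF`: block axioms are all-positive, the other two cannot be falsified
  simp only [cliqueCNF, List.mem_append] at hc
  rcases hc with (hc | hc) | hc
  · obtain ⟨i', -, rfl⟩ := List.mem_map.1 hc
    intro l hl
    rw [List.mem_toFinset] at hl
    obtain ⟨v, -, rfl⟩ := List.mem_map.1 hl
    rfl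
  · exfalso
    obtain ⟨i', -, hc⟩ := List.mem_flatMap.1 hc
    obtain ⟨u', hu', hc⟩ := List.mem_flatMap.1 hc
    obtain ⟨v', hv', hc⟩ := List.mem_flatMap.1 hc
    obtain ⟨u', rfl⟩ : ∃ a : Fin n, u' = (a : ℕ) := by simpa using hu'
    obtain ⟨v', rfl⟩ : ∃ a : Fin n, v' = (a : ℕ) := by simpa using hv'
    split_ifs at hc with huv'
    · have hc : c = [(i' * n + (u' : ℕ), false), (i' * n + (v' : ℕ), false)] := List.mem_singleton.1 hc
      subst hc
      have h1 := hf (i' * n + (u' : ℕ), false) (by simp)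
      have h2 := hf (i' * n + (v' : ℕ), false) (by simp)
      obtain ⟨i₀, hi₀, u₀, hw, -⟩ := run_true_form (r := r) (π := π) Q π.length h1
      have hw : i' * n + (u' : ℕ) = i₀ * n + (u₀ : ℕ) := hw
      obtain ⟨rfl, -⟩ := blockVar_inj hw
      have := hD.block i' hi₀ u' v' h1 h2
      subst this
      exact lt_irrefl _ huv'
    · simp at hc
  · exfalso
    obtain ⟨i', -, hc⟩ := List.mem_flatMap.1 hc
    obtain ⟨j', -, hc⟩ := List.mem_flatMap.1 hc
    obtain ⟨u', -, hc⟩ := List.mem_flatMap.1 hc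
    obtain ⟨v', -, hc⟩ := List.mem_flatMap.1 hc
    split_ifs at hc with hcond
    · have hc : c = [(i' * n + (u' : ℕ), false), (j' * n + (v' : ℕ), false)] := List.mem_singleton.1 hc
      subst hc
      have h1 := hf (i' * n + (u' : ℕ), false) (by simp)
      have h2 := hf (j' * n + (v' : ℕ), false) (by simp)
      obtain ⟨i₀, hi₀, u₀, hwu, hu₀⟩ := run_true_form (r := r) (π := π) Q π.length h1
      obtain ⟨j₀, hj₀, v₀, hwv, hv₀⟩ := run_true_form (r := r) (π := π) Q π.length h2
      have hwu : i' * n + (u' : ℕ) = i₀ * n + (u₀ : ℕ) := hwu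
      have hwv : j' * n + (v' : ℕ) = j₀ * n + (v₀ : ℕ) := hwv
      obtain ⟨rfl, rfl⟩ := blockVar_inj hwu
      obtain ⟨rfl, rfl⟩ := blockVar_inj hwv
      by_cases huv : u' = v'
      · subst huv
        exact hcond.1 (hD.vertex i' hi₀ j' hj₀ u' h1 h2)
      · have : G.Adj u' v' := hQ hu₀ hv₀ huv
        rw [decide_eq_true this] at hcond
        exact Bool.noConfusion hcond.2
    · simp at hc

/-- The rule of a fixed point of `step` inside `π` is `initial`. -/
theorem rule_initial_of_step_eq {φ : CNF ℕ} (ans : (ℕ → Option Bool) → ℕ → Bool) (hπ : IsResDerivation φ π)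
    (st : ℕ × (ℕ → Option Bool)) (hlt : st.1 < π.length) (hfix : step π ans st = st) :
    (π[st.1]'hlt).rule = .initial := by
  have hv := hπ st.1 hlt
  have hlen : (π.take st.1).length = st.1 := by simp [hlt.le]
  unfold IsValidResLine at hv
  unfold step at hfix
  rw [dif_pos hlt] at hfix
  rcases hrule : (π[st.1]'hlt).rule with _ | ⟨i, j, v⟩ | ⟨i⟩
  · rfl
  · rw [hrule] at hv hfix
    obtain ⟨hi, hj, -⟩ := hv
    rw [hlen] at hi hj
    exfalso
    have h1 := congrArg Prod.fst hfix
    simp only [stepRule] at h1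
    split at h1 <;> omega
  · rw [hrule] at hv hfix
    obtain ⟨hi, -⟩ := hv
    rw [hlen] at hi
    exfalso
    have h1 := congrArg Prod.fst hfix
    simp only [stepRule] at h1
    omega

end LastLine

end TreeLike

/-- **Pin-monotone steps keep negative literals** (summary of this file, generic in the answering rule): along the
Prover–Delayer walk on a pin-monotone derivation, a step that lands on a NON-initial line `c'` carries every negative
literal of the old clause into the clause of `c'`. -/
theorem pinMonotone_step_neg_subset :
    ∀ (φ : CNF ℕ) (π : List (ResLine ℕ)) (ans : (ℕ → Option Bool) → ℕ → Bool) (st : ℕ × (ℕ → Option Bool))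
      (c' : ℕ) (hst : st.1 < π.length) (hlt' : c' < π.length),
      IsResDerivation φ π → IsPinMonotone π → (TreeLike.step π ans st).1 = c' →
        (π[c']'hlt').rule ≠ ResRule.initial →
        ∀ l ∈ (π[st.1]'hst).clause, l.2 = false → l ∈ (π[c']'hlt').clause := by
  intro φ π ans st c' hst hlt' hπ hmono hc' hni
  exact TreeLike.step_neg_subset ans hπ hmono st hst hc' hlt' hni

end Summit.PneNP.PneNP.Theorems.RamseyUncertifiableResolutionUncertainty
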